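import Summits.AtomisticToContinuum.Crystallization.Theorems.SquareWellLayerCakeGapTwelveToBarlowUniformSpacingSelectionTemplate
import Literature.MathematicalPhysics.StatisticalMechanics.LennardJonesClusters

/-!
# `stub_uniformSpacingSelection` (crux `GapTwelveToBarlow`, stmt-AtomisticToContinuum-15807), bridge side, V:
# the finite-`N` core of (b1) — a relaxed-matched centre sees the bad sites of its ball as bad layers

Fixed-`N` combinatorics of the hull ⇒ a.e. bridge (`uniformSpacingSelection-REPORT.md`, (b1)) for a
configuration `y : Fin N → ℝ³`: `sel_card_ball_ge` (volume: the index cube of an `(R', ε')`-matched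
template injects into the sites, `≥ (2J+1)³` sites within `4J + 1/4`, `ε' < 1/4`); `sel_card_sep_ball_le`
(packing: `≤ (3r+1)³` everywhere-`55/57`-separated sites in an `r`-ball,
`Literature…card_le_of_separated_of_dist_le`); `sel_rebase` (the template of `i` re-based at the template
point of a site `j` of the ball is `(R, 2ε')`-matched at `j`, `R + r + 1 ≤ R'`); `sel_badLayer_of_badSite`
(so a NOT near-uniformly matched `j` makes its layer a bad base layer, precision `δ`, range `⌈2R⌉₊`);
`sel_bad_ball_le` (`#(Bad ∩ B(i, r)) ≤ #(bad layers in [m₀ − 2(r+1), m₀ + 2(r+1)]) · (8(r+1)+1)(4(r+1)+1)`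
by injectivity of site ↦ template index under separation); `sel_exists_centre` (double counting:
some good centre `i` has `#(Bad ∩ Gd)·v ≤ #Gd · #(Bad ∩ B(i)) + #Gdᶜ · V`).
-/

noncomputable section

namespace Summit.AtomisticToContinuum.Crystallization.Theorems.SquareWellLayerCakeGapTwelveToBarlow

open scoped BigOperators
open Filter Topology Literature.MathematicalPhysics.StatisticalMechanics
open Summit.AtomisticToContinuum.Crystallization.Theorems.LayeredHull


/-- **Volume lower bound.** If the `R'`-window of `y i` is `ε'`-matched (`ε' < 1/4`) to the relaxed template
`(a, s, z, m₀, i₀, j₀, A)` (clause 1) and `4J ≤ R'`, then at least `(2J+1)³` sites lie within `4J + 1/4`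
of `y i`. [folklore] -/
theorem sel_card_ball_ge {N : ℕ} (y : Fin N → (EuclideanSpace ℝ (Fin 3))) (i : Fin N) {a : ℝ} (ha : 47 / 50 ≤ a) (ha1 : a ≤ 1)
    {s : ℤ → ℤ} (hs : IsHaggSeq s) {z : ℤ → ℝ}
    (hz : ∀ m : ℤ, 39 / 50 * a ≤ z (m + 1) - z m ∧ z (m + 1) - z m ≤ 17 / 20 * a)
    (A : (EuclideanSpace ℝ (Fin 3)) →ₗᵢ[ℝ] (EuclideanSpace ℝ (Fin 3))) (m₀ i₀ j₀ : ℤ) {R' ε' : ℝ} (hε' : ε' < 1 / 4) (J : ℕ) (hJ : 4 * (J : ℝ) ≤ R')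
    (hW1 : ∀ m i' j' : ℤ, dist (layeredPos a s z m i' j') (layeredPos a s z m₀ i₀ j₀) ≤ R' →
      ∃ j₂ : Fin N, dist (y j₂) (y i + A (layeredPos a s z m i' j' - layeredPos a s z m₀ i₀ j₀)) ≤ ε') :
    (2 * J + 1) ^ 3 ≤ (Finset.univ.filter fun j : Fin N => dist (y j) (y i) ≤ 4 * J + 1 / 4).card := by
  classical
  -- the assignment of a site to every template point of the `R'`-window
  have hW1' : ∀ t : ℤ × (ℤ × ℤ), ∃ j₂ : Fin N,
      ‖layeredPos a s z t.1 t.2.1 t.2.2 - layeredPos a s z m₀ i₀ j₀‖ ≤ R' →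
        dist (y j₂) (y i + A (layeredPos a s z t.1 t.2.1 t.2.2 - layeredPos a s z m₀ i₀ j₀)) ≤ ε' := by
    intro t
    by_cases ht : ‖layeredPos a s z t.1 t.2.1 t.2.2 - layeredPos a s z m₀ i₀ j₀‖ ≤ R'
    · obtain ⟨j₂, hj₂⟩ := hW1 t.1 t.2.1 t.2.2 (by rwa [dist_eq_norm])
      exact ⟨j₂, fun _ => hj₂⟩
    · exact ⟨i, fun h => absurd h ht⟩
  choose g hg using hW1'
  set T : Finset (ℤ × (ℤ × ℤ)) := Finset.Icc (m₀ - J) (m₀ + J) ×ˢ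
    (Finset.Icc (i₀ - J) (i₀ + J) ×ˢ Finset.Icc (j₀ - J) (j₀ + J)) with hT
  have hTcard : T.card = (2 * J + 1) ^ 3 := by
    rw [hT, Finset.card_product, Finset.card_product, Int.card_Icc, Int.card_Icc, Int.card_Icc]
    have e1 : (m₀ + J + 1 - (m₀ - J)).toNat = 2 * J + 1 := by omega
    have e2 : (i₀ + J + 1 - (i₀ - J)).toNat = 2 * J + 1 := by omega
    have e3 : (j₀ + J + 1 - (j₀ - J)).toNat = 2 * J + 1 := by omega
    rw [e1, e2, e3]; ring
  -- norms of the cube points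
  have hnorm : ∀ t ∈ T, ‖layeredPos a s z t.1 t.2.1 t.2.2 - layeredPos a s z m₀ i₀ j₀‖ ≤ 4 * J := by
    intro t ht
    refine sel_cube_norm_le ha ha1 hs hz m₀ i₀ j₀ J _ (Finset.mem_image.2 ⟨t, ht, rfl⟩)
  rw [← hTcard]
  refine Finset.card_le_card_of_injOn g (fun t ht => ?_) ?_
  · -- `g t` is within `4J + 1/4` of `y i`
    have h1 := hg t ((hnorm t ht).trans hJ)
    rw [Finset.coe_filter, Set.mem_setOf_eq]
    refine ⟨Finset.mem_univ _, ?_⟩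
    calc dist (y (g t)) (y i) ≤ dist (y (g t)) (y i + A (layeredPos a s z t.1 t.2.1 t.2.2 -
          layeredPos a s z m₀ i₀ j₀)) + dist (y i + A (layeredPos a s z t.1 t.2.1 t.2.2 -
          layeredPos a s z m₀ i₀ j₀)) (y i) := dist_triangle _ _ _
      _ ≤ ε' + 4 * J := by
          refine add_le_add h1 ?_
          rw [dist_comm, dist_eq_norm, sub_add_cancel_left, norm_neg, A.norm_map]
          exact hnorm t ht
      _ ≤ 4 * J + 1 / 4 := by linarith
  · -- injectivity: two cube points with the same site are `< 1/2` apart, hence equal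
    intro t ht t' ht' hgg
    have h1 := hg t ((hnorm t ht).trans hJ)
    have h2 := hg t' ((hnorm t' ht').trans hJ)
    rw [hgg] at h1
    by_contra hne
    have hsep := sel_layeredPos_sep ha s (fun m => (hz m).1) (m := t.1) (i := t.2.1) (j := t.2.2)
      (m' := t'.1) (i' := t'.2.1) (j' := t'.2.2) (by
        intro h; apply hne
        obtain ⟨m, i, j⟩ := t
        obtain ⟨m', i', j'⟩ := t'
        simp only [Prod.mk.injEq] at h ⊢
        exact ⟨h.1, h.2.1, h.2.2⟩)
    have hd : dist (y i + A (layeredPos a s z t.1 t.2.1 t.2.2 - layeredPos a s z m₀ i₀ j₀))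
        (y i + A (layeredPos a s z t'.1 t'.2.1 t'.2.2 - layeredPos a s z m₀ i₀ j₀)) =
        dist (layeredPos a s z t.1 t.2.1 t.2.2) (layeredPos a s z t'.1 t'.2.1 t'.2.2) := by
      rw [dist_add_left, A.dist_map, dist_eq_norm, dist_eq_norm, sub_sub_sub_cancel_right]
    have := dist_triangle_left (y i + A (layeredPos a s z t.1 t.2.1 t.2.2 - layeredPos a s z m₀ i₀ j₀))
      (y i + A (layeredPos a s z t'.1 t'.2.1 t'.2.2 - layeredPos a s z m₀ i₀ j₀)) (y (g t'))
    rw [hd] at this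
    linarith

/-- **Packing.** At most `(3r+1)³` sites that are `55/57`-separated from all other sites lie in a ball of
radius `r`. [folklore] -/
theorem sel_card_sep_ball_le {N : ℕ} (y : Fin N → (EuclideanSpace ℝ (Fin 3))) (p : (EuclideanSpace ℝ (Fin 3))) {r : ℝ} (hr : 0 ≤ r) (G : Finset (Fin N))
    (hG : ∀ j ∈ G, ∀ k : Fin N, k ≠ j → (55 : ℝ) / 57 ≤ dist (y j) (y k)) :
    (((G.filter fun j => dist (y j) p ≤ r).card : ℕ) : ℝ) ≤ (3 * r + 1) ^ 3 := by
  classical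
  have hinj : Set.InjOn y ↑(G.filter fun j => dist (y j) p ≤ r) := by
    intro j hj k hk hjk
    by_contra hne
    have h := hG j (Finset.mem_filter.1 hj).1 k (Ne.symm hne)
    rw [hjk, dist_self] at h
    norm_num at h
  have hcard := Finset.card_image_of_injOn hinj
  rw [← hcard]
  have h := card_le_of_separated_of_dist_le ((G.filter fun j => dist (y j) p ≤ r).image y) p
    (by norm_num : (0 : ℝ) < 55 / 57) hr ?_ ?_
  · rw [finrank_euclideanSpace_fin] at h
    refine h.trans ?_
    have : 2 * r / (55 / 57) + 1 ≤ 3 * r + 1 := by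
      rw [div_add_one (by norm_num), div_le_iff₀ (by norm_num)]; nlinarith
    exact pow_le_pow_left₀ (by positivity) this 3
  · intro c hc
    obtain ⟨j, hj, rfl⟩ := Finset.mem_image.1 hc
    exact (Finset.mem_filter.1 hj).2
  · intro c hc d hd hcd
    obtain ⟨j, hj, rfl⟩ := Finset.mem_image.1 hc
    obtain ⟨k, hk, rfl⟩ := Finset.mem_image.1 hd
    exact hG j (Finset.mem_filter.1 hj).1 k (fun h => hcd (by rw [h]))

/-- **Rebasing.** If the `R'`-window of `y i` is two-way `ε'`-matched to the template with base
`(m₀, i₀, j₀)`, `y j` is within `r` of `y i` and within `ε'` of the template point `(m₁, i₁, j₁)`, and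
`R + r + 1 ≤ R'`, `ε' ≤ 1/2`, then the `R`-window of `y j` is two-way `2ε'`-matched to the same template
with base `(m₁, i₁, j₁)`. [folklore] -/
theorem sel_rebase {N : ℕ} (y : Fin N → (EuclideanSpace ℝ (Fin 3))) (i j : Fin N) (a : ℝ) (s : ℤ → ℤ) (z : ℤ → ℝ)
    (A : (EuclideanSpace ℝ (Fin 3)) →ₗᵢ[ℝ] (EuclideanSpace ℝ (Fin 3))) (m₀ i₀ j₀ m₁ i₁ j₁ : ℤ) {R R' ε' r : ℝ} (hRR : R + r + 1 ≤ R') (hε1 : ε' ≤ 1 / 2)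
    (hW1 : ∀ m i' j' : ℤ, dist (layeredPos a s z m i' j') (layeredPos a s z m₀ i₀ j₀) ≤ R' →
      ∃ j₂ : Fin N, dist (y j₂) (y i + A (layeredPos a s z m i' j' - layeredPos a s z m₀ i₀ j₀)) ≤ ε')
    (hW2 : ∀ j₂ : Fin N, dist (y j₂) (y i) ≤ R' →
      ∃ m i' j' : ℤ, dist (y j₂) (y i + A (layeredPos a s z m i' j' - layeredPos a s z m₀ i₀ j₀)) ≤ ε')
    (hj : dist (y j) (y i) ≤ r)
    (ht : dist (y j) (y i + A (layeredPos a s z m₁ i₁ j₁ - layeredPos a s z m₀ i₀ j₀)) ≤ ε') :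
    (∀ m i' j' : ℤ, dist (layeredPos a s z m i' j') (layeredPos a s z m₁ i₁ j₁) ≤ R →
      ∃ j₂ : Fin N, dist (y j₂) (y j + A (layeredPos a s z m i' j' - layeredPos a s z m₁ i₁ j₁)) ≤ 2 * ε') ∧
    (∀ j₂ : Fin N, dist (y j₂) (y j) ≤ R →
      ∃ m i' j' : ℤ, dist (y j₂) (y j + A (layeredPos a s z m i' j' - layeredPos a s z m₁ i₁ j₁)) ≤ 2 * ε') := by
  -- the base point of `j` is within `r + ε'` of the base point of `i`
  have hbase : dist (layeredPos a s z m₁ i₁ j₁) (layeredPos a s z m₀ i₀ j₀) ≤ r + ε' := by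
    have e : dist (layeredPos a s z m₁ i₁ j₁) (layeredPos a s z m₀ i₀ j₀) =
        dist (y i + A (layeredPos a s z m₁ i₁ j₁ - layeredPos a s z m₀ i₀ j₀)) (y i) := by
      rw [dist_eq_norm, dist_eq_norm, add_sub_cancel_left, A.norm_map]
    rw [e]
    calc _ ≤ dist (y i + A (layeredPos a s z m₁ i₁ j₁ - layeredPos a s z m₀ i₀ j₀)) (y j) + dist (y j) (y i) :=
          dist_triangle _ _ _
      _ ≤ ε' + r := add_le_add (by rwa [dist_comm]) hj
      _ = r + ε' := add_comm _ _
  -- the key identity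
  have key : ∀ p : (EuclideanSpace ℝ (Fin 3)), y j + A (p - layeredPos a s z m₁ i₁ j₁) =
      (y i + A (p - layeredPos a s z m₀ i₀ j₀)) +
        (y j - (y i + A (layeredPos a s z m₁ i₁ j₁ - layeredPos a s z m₀ i₀ j₀))) := by
    intro p
    rw [map_sub, map_sub, map_sub]
    abel
  have herr : ‖y j - (y i + A (layeredPos a s z m₁ i₁ j₁ - layeredPos a s z m₀ i₀ j₀))‖ ≤ ε' := by
    rwa [← dist_eq_norm]
  refine ⟨fun m i' j' hm => ?_, fun j₂ hj₂ => ?_⟩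
  · have hR' : dist (layeredPos a s z m i' j') (layeredPos a s z m₀ i₀ j₀) ≤ R' :=
      ((dist_triangle _ (layeredPos a s z m₁ i₁ j₁) _).trans (add_le_add hm hbase)).trans (by linarith)
    obtain ⟨j₂, hj₂⟩ := hW1 m i' j' hR'
    refine ⟨j₂, ?_⟩
    rw [key]
    calc dist (y j₂) ((y i + A (layeredPos a s z m i' j' - layeredPos a s z m₀ i₀ j₀)) +
          (y j - (y i + A (layeredPos a s z m₁ i₁ j₁ - layeredPos a s z m₀ i₀ j₀))))
        ≤ dist (y j₂) (y i + A (layeredPos a s z m i' j' - layeredPos a s z m₀ i₀ j₀)) +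
          ‖y j - (y i + A (layeredPos a s z m₁ i₁ j₁ - layeredPos a s z m₀ i₀ j₀))‖ := by
          rw [dist_eq_norm, dist_eq_norm, show ∀ u v w : (EuclideanSpace ℝ (Fin 3)), u - (v + w) = (u - v) - w from fun u v w => by abel]
          exact norm_sub_le _ _
      _ ≤ ε' + ε' := add_le_add hj₂ herr
      _ = 2 * ε' := by ring
  · have hR' : dist (y j₂) (y i) ≤ R' := ((dist_triangle _ (y j) _).trans (add_le_add hj₂ hj)).trans (by linarith)
    obtain ⟨m, i', j', hm⟩ := hW2 j₂ hR'
    refine ⟨m, i', j', ?_⟩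
    rw [key]
    calc dist (y j₂) ((y i + A (layeredPos a s z m i' j' - layeredPos a s z m₀ i₀ j₀)) +
          (y j - (y i + A (layeredPos a s z m₁ i₁ j₁ - layeredPos a s z m₀ i₀ j₀))))
        ≤ dist (y j₂) (y i + A (layeredPos a s z m i' j' - layeredPos a s z m₀ i₀ j₀)) +
          ‖y j - (y i + A (layeredPos a s z m₁ i₁ j₁ - layeredPos a s z m₀ i₀ j₀))‖ := by
          rw [dist_eq_norm, dist_eq_norm, show ∀ u v w : (EuclideanSpace ℝ (Fin 3)), u - (v + w) = (u - v) - w from fun u v w => by abel]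
          exact norm_sub_le _ _
      _ ≤ ε' + ε' := add_le_add hm herr
      _ = 2 * ε' := by ring

/-- **Bad site ⇒ bad layer.** If the `R`-window of `y j` is two-way `2ε'`-matched to the template with
base `(m₁, i₁, j₁)` (`2ε' ≤ ε`) and `y j` is NOT near-uniformly relaxed-matched at `(R, ε, δ)`, then the
heights are not `δ`-close to arithmetic around `m₁` on `|m − m₁| ≤ ⌈2R⌉₊`. [folklore] -/
theorem sel_badLayer_of_badSite {N : ℕ} (y : Fin N → (EuclideanSpace ℝ (Fin 3))) (j : Fin N) {a : ℝ} (ha : 47 / 50 ≤ a) (ha1 : a ≤ 1)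
    {s : ℤ → ℤ} (hs : IsHaggSeq s) {z : ℤ → ℝ}
    (hz : ∀ m : ℤ, 39 / 50 * a ≤ z (m + 1) - z m ∧ z (m + 1) - z m ≤ 17 / 20 * a)
    (A : (EuclideanSpace ℝ (Fin 3)) →ₗᵢ[ℝ] (EuclideanSpace ℝ (Fin 3))) (m₁ i₁ j₁ : ℤ) {R ε ε' δ : ℝ} (hε : 2 * ε' ≤ ε)
    (hV1 : ∀ m i' j' : ℤ, dist (layeredPos a s z m i' j') (layeredPos a s z m₁ i₁ j₁) ≤ R →
      ∃ j₂ : Fin N, dist (y j₂) (y j + A (layeredPos a s z m i' j' - layeredPos a s z m₁ i₁ j₁)) ≤ 2 * ε')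
    (hV2 : ∀ j₂ : Fin N, dist (y j₂) (y j) ≤ R →
      ∃ m i' j' : ℤ, dist (y j₂) (y j + A (layeredPos a s z m i' j' - layeredPos a s z m₁ i₁ j₁)) ≤ 2 * ε')
    (hbad : ¬ (∃ a : ℝ, 47 / 50 ≤ a ∧ a ≤ 1 ∧ ∃ s : ℤ → ℤ, IsHaggSeq s ∧ ∃ z : ℤ → ℝ,
          (∀ m : ℤ, 39 / 50 * a ≤ z (m + 1) - z m ∧ z (m + 1) - z m ≤ 17 / 20 * a) ∧
          ∃ m₀ i₀ j₀ : ℤ, ∃ A : EuclideanSpace ℝ (Fin 3) →ₗᵢ[ℝ] EuclideanSpace ℝ (Fin 3),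
          (∃ h : ℝ, ∀ m : ℤ, |(m : ℝ) - m₀| ≤ 2 * R → |z m - z m₀ - ((m : ℝ) - m₀) * h| ≤ δ) ∧
          (∀ m i' j' : ℤ, dist (layeredPos a s z m i' j') (layeredPos a s z m₀ i₀ j₀) ≤ R →
            ∃ j₂ : Fin N, dist (y j₂) (y j + A (layeredPos a s z m i' j' - layeredPos a s z m₀ i₀ j₀)) ≤ ε) ∧
          (∀ j₂ : Fin N, dist (y j₂) (y j) ≤ R → ∃ m i' j' : ℤ,
            dist (y j₂) (y j + A (layeredPos a s z m i' j' - layeredPos a s z m₀ i₀ j₀)) ≤ ε))) :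
    ¬ ∃ h : ℝ, ∀ m' : ℤ, |(m' : ℝ) - m₁| ≤ (⌈2 * R⌉₊ : ℕ) → |z m' - z m₁ - ((m' : ℝ) - m₁) * h| ≤ δ := by
  rintro ⟨h, hh⟩
  apply hbad
  refine ⟨a, ha, ha1, s, hs, z, hz, m₁, i₁, j₁, A, ⟨h, fun m hm => hh m (hm.trans (Nat.le_ceil _))⟩,
    fun m i' j' hm => ?_, fun j₂ hj₂ => ?_⟩
  · obtain ⟨j₂, hj₂⟩ := hV1 m i' j' hm
    exact ⟨j₂, hj₂.trans hε⟩
  · obtain ⟨m, i', j', hm⟩ := hV2 j₂ hj₂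
    exact ⟨m, i', j', hm.trans hε⟩

/-- **Bad sites of a ball versus bad layers.** Let the `R'`-window of `y i` be two-way `ε'`-matched to a
relaxed template, all sites within `r + 1` of `y i` `55/57`-separated from everything, `ε' < 55/114`,
`2ε' ≤ ε`, `R + r + 1 ≤ R'`.  Then the sites of `B(y i, r)` that are not near-uniformly matched at
`(R, ε, δ)` number at most `#M · (8(r+1)+1)(4(r+1)+1)` for a set `M ⊆ [m₀ − 2(r+1), m₀ + 2(r+1)]` of bad
base layers (precision `δ`, range `⌈2R⌉₊`) of the template. [folklore] -/
theorem sel_bad_ball_le {N : ℕ} (y : Fin N → (EuclideanSpace ℝ (Fin 3))) (i : Fin N) {a : ℝ} (ha : 47 / 50 ≤ a) (ha1 : a ≤ 1)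
    {s : ℤ → ℤ} (hs : IsHaggSeq s) {z : ℤ → ℝ}
    (hz : ∀ m : ℤ, 39 / 50 * a ≤ z (m + 1) - z m ∧ z (m + 1) - z m ≤ 17 / 20 * a)
    (A : (EuclideanSpace ℝ (Fin 3)) →ₗᵢ[ℝ] (EuclideanSpace ℝ (Fin 3))) (m₀ i₀ j₀ : ℤ) {R R' ε ε' δ : ℝ} (r : ℕ)
    (hε'1 : ε' < 55 / 114) (hε : 2 * ε' ≤ ε) (hR : 0 ≤ R) (hRR : R + r + 1 ≤ R')
    (hW1 : ∀ m i' j' : ℤ, dist (layeredPos a s z m i' j') (layeredPos a s z m₀ i₀ j₀) ≤ R' →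
      ∃ j₂ : Fin N, dist (y j₂) (y i + A (layeredPos a s z m i' j' - layeredPos a s z m₀ i₀ j₀)) ≤ ε')
    (hW2 : ∀ j₂ : Fin N, dist (y j₂) (y i) ≤ R' →
      ∃ m i' j' : ℤ, dist (y j₂) (y i + A (layeredPos a s z m i' j' - layeredPos a s z m₀ i₀ j₀)) ≤ ε')
    (hsep : ∀ j : Fin N, dist (y j) (y i) ≤ r + 1 → ∀ k : Fin N, k ≠ j → (55 : ℝ) / 57 ≤ dist (y j) (y k))
    (Bad : Finset (Fin N)) (hBad : ∀ j ∈ Bad, ¬ (∃ a : ℝ, 47 / 50 ≤ a ∧ a ≤ 1 ∧ ∃ s : ℤ → ℤ, IsHaggSeq s ∧ ∃ z : ℤ → ℝ,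
          (∀ m : ℤ, 39 / 50 * a ≤ z (m + 1) - z m ∧ z (m + 1) - z m ≤ 17 / 20 * a) ∧
          ∃ m₀ i₀ j₀ : ℤ, ∃ A : EuclideanSpace ℝ (Fin 3) →ₗᵢ[ℝ] EuclideanSpace ℝ (Fin 3),
          (∃ h : ℝ, ∀ m : ℤ, |(m : ℝ) - m₀| ≤ 2 * R → |z m - z m₀ - ((m : ℝ) - m₀) * h| ≤ δ) ∧
          (∀ m i' j' : ℤ, dist (layeredPos a s z m i' j') (layeredPos a s z m₀ i₀ j₀) ≤ R →
            ∃ j₂ : Fin N, dist (y j₂) (y j + A (layeredPos a s z m i' j' - layeredPos a s z m₀ i₀ j₀)) ≤ ε) ∧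
          (∀ j₂ : Fin N, dist (y j₂) (y j) ≤ R → ∃ m i' j' : ℤ,
            dist (y j₂) (y j + A (layeredPos a s z m i' j' - layeredPos a s z m₀ i₀ j₀)) ≤ ε))) :
    ∃ M : Finset ℤ, M ⊆ Finset.Icc (m₀ - 2 * (r + 1)) (m₀ + 2 * (r + 1)) ∧
      (∀ m ∈ M, (¬ ∃ h : ℝ, ∀ m' : ℤ, |(m' : ℝ) - m| ≤ (⌈2 * R⌉₊ : ℕ) → |z m' - z m - ((m' : ℝ) - m) * h| ≤ δ)) ∧
      (Bad.filter fun j => dist (y j) (y i) ≤ r).card ≤ M.card * ((8 * (r + 1) + 1) * (4 * (r + 1) + 1)) := by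
  classical
  have hε'0 : ε' ≤ 1 / 2 := by linarith
  have hR0 : (r : ℝ) ≤ R' := by linarith
  -- template indices of the sites of the ball
  have hW2' : ∀ j₂ : Fin N, ∃ t : ℤ × (ℤ × ℤ), dist (y j₂) (y i) ≤ r →
      dist (y j₂) (y i + A (layeredPos a s z t.1 t.2.1 t.2.2 - layeredPos a s z m₀ i₀ j₀)) ≤ ε' := by
    intro j₂
    by_cases hj : dist (y j₂) (y i) ≤ r
    · obtain ⟨m, i', j', h⟩ := hW2 j₂ (hj.trans hR0)
      exact ⟨(m, (i', j')), fun _ => h⟩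
    · exact ⟨(m₀, (i₀, j₀)), fun h => absurd h hj⟩
  choose τ hτ using hW2'
  set Ball : Finset (Fin N) := Bad.filter fun j => dist (y j) (y i) ≤ r with hBall
  -- the bad layers
  set M : Finset ℤ := (Ball.image fun j => (τ j).1) with hM
  -- (1) norm bound of the template offsets of the ball
  have hoff : ∀ j ∈ Ball, ‖layeredPos a s z (τ j).1 (τ j).2.1 (τ j).2.2 - layeredPos a s z m₀ i₀ j₀‖ ≤ (r + 1 : ℕ) := by
    intro j hj
    have hjr : dist (y j) (y i) ≤ r := (Finset.mem_filter.1 hj).2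
    have h1 := hτ j hjr
    have e : ‖layeredPos a s z (τ j).1 (τ j).2.1 (τ j).2.2 - layeredPos a s z m₀ i₀ j₀‖ =
        dist (y i + A (layeredPos a s z (τ j).1 (τ j).2.1 (τ j).2.2 - layeredPos a s z m₀ i₀ j₀)) (y i) := by
      rw [dist_eq_norm, add_sub_cancel_left, A.norm_map]
    rw [e]
    push_cast
    calc _ ≤ dist (y i + A (layeredPos a s z (τ j).1 (τ j).2.1 (τ j).2.2 - layeredPos a s z m₀ i₀ j₀)) (y j) +
          dist (y j) (y i) := dist_triangle _ _ _
      _ ≤ ε' + r := add_le_add (by rwa [dist_comm]) hjr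
      _ ≤ r + 1 := by linarith
  -- (2) injectivity of `τ` on the ball
  have hinj : Set.InjOn τ ↑Ball := by
    intro j hj k hk hjk
    by_contra hne
    have hjr : dist (y j) (y i) ≤ r := (Finset.mem_filter.1 (Finset.mem_coe.1 hj)).2
    have hkr : dist (y k) (y i) ≤ r := (Finset.mem_filter.1 (Finset.mem_coe.1 hk)).2
    have h1 := hτ j hjr
    have h2 := hτ k hkr
    rw [hjk] at h1
    have hs' := hsep j (hjr.trans (by linarith)) k (Ne.symm hne)
    have := dist_triangle_right (y j) (y k) (y i + A (layeredPos a s z (τ k).1 (τ k).2.1 (τ k).2.2 -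
      layeredPos a s z m₀ i₀ j₀))
    linarith
  refine ⟨M, ?_, ?_, ?_⟩
  · -- `M ⊆ [m₀ − 2(r+1), m₀ + 2(r+1)]`
    intro m hm
    obtain ⟨j, hj, rfl⟩ := Finset.mem_image.1 hm
    obtain ⟨hm1, -, -⟩ := sel_index_bounds ha hs hz (hoff j hj)
    rw [abs_le] at hm1
    push_cast at hm1
    rw [Finset.mem_Icc]
    constructor
    · have : ((m₀ - 2 * (r + 1) : ℤ) : ℝ) ≤ (τ j).1 := by push_cast; linarith [hm1.1]
      exact_mod_cast this
    · have : (((τ j).1 : ℤ) : ℝ) ≤ ((m₀ + 2 * (r + 1) : ℤ) : ℝ) := by push_cast; linarith [hm1.2]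
      exact_mod_cast this
  · -- every layer of `M` is bad
    intro m hm
    obtain ⟨j, hj, rfl⟩ := Finset.mem_image.1 hm
    obtain ⟨hjB, hjr⟩ := Finset.mem_filter.1 hj
    obtain ⟨hV1, hV2⟩ := sel_rebase y i j a s z A m₀ i₀ j₀ (τ j).1 (τ j).2.1 (τ j).2.2 hRR hε'0 hW1 hW2
      hjr (hτ j hjr)
    exact sel_badLayer_of_badSite y j ha ha1 hs hz A (τ j).1 (τ j).2.1 (τ j).2.2 hε hV1 hV2 (hBad j hjB)
  · -- counting along the fibres of the layer map
    have hcover : Ball ⊆ M.biUnion fun m => Ball.filter fun j => (τ j).1 = m := by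
      intro j hj
      rw [Finset.mem_biUnion]
      exact ⟨(τ j).1, Finset.mem_image.2 ⟨j, hj, rfl⟩, Finset.mem_filter.2 ⟨hj, rfl⟩⟩
    refine (Finset.card_le_card hcover).trans (Finset.card_biUnion_le_card_mul _ _ _ fun m _ => ?_)
    -- the fibre over `m` injects into the index pairs of layer `m` within `r + 1`
    have hF := sel_card_perLayer_le ha hs hz m m₀ i₀ j₀ (r + 1)
      ((Ball.filter fun j => (τ j).1 = m).image fun j => ((τ j).2.1, (τ j).2.2)) (by
        intro ij hij
        obtain ⟨j, hj, rfl⟩ := Finset.mem_image.1 hij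
        obtain ⟨hjB, hjm⟩ := Finset.mem_filter.1 hj
        rw [← hjm]
        exact hoff j hjB)
    rw [Finset.card_image_of_injOn] at hF
    · exact hF
    · intro j hj k hk hjk
      obtain ⟨hjB, hjm⟩ := Finset.mem_filter.1 (Finset.mem_coe.1 hj)
      obtain ⟨hkB, hkm⟩ := Finset.mem_filter.1 (Finset.mem_coe.1 hk)
      refine hinj (Finset.mem_coe.2 hjB) (Finset.mem_coe.2 hkB) ?_
      simp only [Prod.mk.injEq] at hjk
      exact Prod.ext (hjm.trans hkm.symm) (Prod.ext hjk.1 hjk.2)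

/-- **Double counting.** For a relation `near` on a finite type, a set `Gd` of good centres each
having at least `v` near sites, and at most `V` good sites near any site, some good centre `i` satisfies
`#(Bad ∩ Gd) · v ≤ #Gd · #{j ∈ Bad | near i j} + #Gdᶜ · V`. [folklore] -/
theorem sel_exists_centre {ι : Type*} [Fintype ι] [DecidableEq ι] (near : ι → ι → Prop)
    [∀ i j, Decidable (near i j)] (Bad Gd : Finset ι)
    (hGd : Gd.Nonempty) (v V : ℕ)
    (hv : ∀ j ∈ Gd, v ≤ (Finset.univ.filter fun i => near i j).card)
    (hV : ∀ i : ι, (Gd.filter fun j => near i j).card ≤ V) :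
    ∃ i ∈ Gd, (Bad ∩ Gd).card * v ≤
      Gd.card * (Bad.filter fun j => near i j).card + (Finset.univ \ Gd).card * V := by
  classical
  -- the centre with the most bad near sites
  obtain ⟨i, hi, hmax⟩ := Finset.exists_max_image Gd (fun i => (Bad.filter fun j => near i j).card) hGd
  refine ⟨i, hi, ?_⟩
  -- the double-counting sum
  set S : ℕ := ∑ i' ∈ Gd, (Bad.filter fun j => near i' j).card with hS
  have hS1 : S ≤ Gd.card * (Bad.filter fun j => near i j).card := by
    rw [hS, ← smul_eq_mul]
    exact Finset.sum_le_card_nsmul _ _ _ hmax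
  -- swap the sums
  have hswap : S = ∑ j ∈ Bad, (Gd.filter fun i' => near i' j).card := by
    rw [hS]
    simp only [Finset.card_filter]
    exact Finset.sum_comm
  -- lower bound: restrict to `j ∈ Bad ∩ Gd`
  have hS2 : ∑ j ∈ Bad ∩ Gd, (Gd.filter fun i' => near i' j).card ≤ S := by
    rw [hswap]
    exact Finset.sum_le_sum_of_subset_of_nonneg Finset.inter_subset_left fun _ _ _ => Nat.zero_le _
  -- for each `j`: near sites = good near sites + bad near sites
  have hsplit : ∀ j, (Finset.univ.filter fun i' => near i' j).card =
      (Gd.filter fun i' => near i' j).card + ((Finset.univ \ Gd).filter fun i' => near i' j).card := by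
    intro j
    rw [← Finset.card_union_of_disjoint (Finset.disjoint_filter_filter Finset.disjoint_sdiff),
      ← Finset.filter_union, Finset.union_sdiff_of_subset (Finset.subset_univ _)]
  have hS3 : (Bad ∩ Gd).card * v ≤ ∑ j ∈ Bad ∩ Gd, (Gd.filter fun i' => near i' j).card +
      ∑ j ∈ Bad ∩ Gd, ((Finset.univ \ Gd).filter fun i' => near i' j).card := by
    rw [← Finset.sum_add_distrib, ← smul_eq_mul]
    refine Finset.card_nsmul_le_sum _ _ _ fun j hj => ?_
    rw [← hsplit]
    exact hv j (Finset.mem_inter.1 hj).2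
  -- the non-good contributions: swap again and use the packing bound
  have hS4 : ∑ j ∈ Bad ∩ Gd, ((Finset.univ \ Gd).filter fun i' => near i' j).card ≤
      (Finset.univ \ Gd).card * V := by
    have e : ∑ j ∈ Bad ∩ Gd, ((Finset.univ \ Gd).filter fun i' => near i' j).card =
        ∑ i' ∈ Finset.univ \ Gd, ((Bad ∩ Gd).filter fun j => near i' j).card := by
      simp only [Finset.card_filter]
      exact Finset.sum_comm
    rw [e, ← smul_eq_mul]
    refine Finset.sum_le_card_nsmul _ _ _ fun i' _ => ?_
    refine le_trans (Finset.card_le_card ?_) (hV i')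
    intro j hj
    obtain ⟨hj1, hj2⟩ := Finset.mem_filter.1 hj
    exact Finset.mem_filter.2 ⟨(Finset.mem_inter.1 hj1).2, hj2⟩
  linarith

/-- **Anchor (registered sub-goal form of `sel_card_sep_ball_le`, closed statement):** packing bound for
`55/57`-separated sites in a ball. [folklore] -/
theorem stub_cardSepBallLe :
    ∀ (N : ℕ) (y : Fin N → EuclideanSpace ℝ (Fin 3)) (p : EuclideanSpace ℝ (Fin 3)) (r : ℝ), 0 ≤ r →
      ∀ (G : Finset (Fin N)), (∀ j ∈ G, ∀ k : Fin N, k ≠ j → (55 : ℝ) / 57 ≤ dist (y j) (y k)) →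
        (((G.filter fun j => dist (y j) p ≤ r).card : ℕ) : ℝ) ≤ (3 * r + 1) ^ 3 :=
  fun _ y p _ hr G hG => sel_card_sep_ball_le y p hr G hG

end Summit.AtomisticToContinuum.Crystallization.Theorems.SquareWellLayerCakeGapTwelveToBarlow

end
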